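import Literature.Computability.AlgebraicComplexity.BorderRankMatMulThreeKernelGroup
import HarnessLib

/-!
# Borel-fixed `(110)`-candidates of `⟨3,3,3⟩`, VIII: soundness of the kernel procedure, the bound

Topic `Literature/Computability/AlgebraicComplexity`. Last part of the soundness proof of
`BorderRankMatMulThreeKernel.lean` (after `…KernelSound.lean`: semantics; `…KernelGroup.lean`:
an accepted group is a non-singular minor, hence independent columns):

* `MatMul3.Ker.certRank_le_finrank` — columns of distinct weights have disjoint supports
  (`colSpan_support`, `certSpan_support`), so over a well-formed certificate the certified ranks
  ADD inside the span of the columns;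
* `MatMul3.Ker.finrank_test_le_boundOf`, `finrank_test_le_boundT` — **the certified bound is
  sound**: `dim testI E ≤ boundT prof var false` and `dim testK E ≤ boundT prof var true` for every
  `E` containing the model vectors of the variant with `dim E ≤` their number (rank–nullity
  `finrank_testI_add`; generic variant under `α, β, α - β ≠ 0`).

## References

* A. Conner, A. Harper, J. M. Landsberg, *New lower bounds for matrix multiplication and `det₃`*,
  Forum Math. Pi 11 (2023) e17, arXiv:1911.07981 — §3, §6. [ConnerHarperLandsberg2023]
-/

noncomputable section

open scoped BigOperators

namespace Literature.Computability.AlgebraicComplexity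

namespace BorderApolarity

namespace MatMul3

namespace Ker

universe u

variable {K : Type u} [Field K]

/-! ## The certificate: ranks add over distinct weights -/

section Cert

variable (tk : Bool) (α β : K) (vs : List MVec)

/-- The span of the columns of a group. [folklore] -/
def colSpan (g : CGroup) : Submodule K (I9' × I9' × I9' → K) :=
  Submodule.span K (Set.range fun r : Fin g.cols.length => colOf tk α β vs (g.cols.getD r (0, 0)))

/-- The span of the columns of a certificate. [folklore] -/
def certSpan : List CGroup → Submodule K (I9' × I9' × I9' → K)
  | [] => ⊥
  | g :: rest => colSpan tk α β vs g ⊔ certSpan rest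

variable {tk vs}

/-- All columns of a group have the group weight. [folklore] -/
theorem groupWt_spec {g : CGroup} {w : ℕ} (h : groupWt tk vs g = some w) :
    ∀ sm ∈ g.cols, colWt tk (vs.getD sm.2 (.unit 0 0 0)) sm.1 = w := by
  unfold groupWt at h
  split at h
  · simp at h
  · rename_i sm rest heq
    dsimp only at h
    split_ifs at h with hall
    simp only [Option.some.injEq] at h
    intro sm' hsm'
    rw [heq, List.mem_cons] at hsm'
    rcases hsm' with rfl | hmem
    · exact h
    · rw [← h]; simpa using (List.all_eq_true.1 hall) sm' hmem

/-- `rowsOK` gives the group weight. [folklore] -/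
theorem groupWt_isSome_of_rowsOK {g : CGroup} (h : rowsOK tk vs g = true) : ∃ w, groupWt tk vs g = some w := by
  unfold rowsOK at h
  split at h
  · simp at h
  · exact ⟨_, by assumption⟩

variable {α β}

/-- **Columns of a group are supported on rows of the group weight.** [folklore] -/
theorem colSpan_support (hwf : ∀ v ∈ vs, v.wf) {g : CGroup} (hc : colsOK vs g = true) {w : ℕ}
    (hw : groupWt tk vs g = some w) {x : I9' × I9' × I9' → K} (hx : x ∈ colSpan tk α β vs g)
    {y : I9' × I9' × I9'} (hy : x y ≠ 0) : rowWt tk (codeA y.1, codeA y.2.1, codeA y.2.2) = w := by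
  induction hx using Submodule.span_induction generalizing y with
  | mem x hxs =>
    obtain ⟨r, rfl⟩ := hxs
    have hmem : g.cols.getD r (0, 0) ∈ g.cols := by
      rw [List.getD_eq_getElem?_getD, List.getElem?_eq_getElem r.isLt]; exact List.getElem_mem _
    have hs : (g.cols.getD r (0, 0)).1 < 9 := by
      simp only [colsOK, List.all_eq_true] at hc
      exact (by simpa using hc _ hmem : _ ∧ _).1
    rw [colOf_ne_zero tk α β hwf _ hy, codeA_decode9 hs]
    exact groupWt_spec hw _ hmem
  | zero => exact absurd rfl hy
  | add x x' _ _ ihx ihx' =>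
    by_cases h : x y = 0
    · exact ihx' (by rw [Pi.add_apply, h, zero_add] at hy; exact hy)
    · exact ihx h
  | smul c x _ ihx =>
    rw [Pi.smul_apply, smul_eq_mul] at hy
    exact ihx (right_ne_zero_of_mul hy)

/-- Columns of a certificate are supported on rows of the certificate's weights. [folklore] -/
theorem certSpan_support (hwf : ∀ v ∈ vs, v.wf) {cert : List CGroup}
    (hall : ∀ g ∈ cert, colsOK vs g = true ∧ rowsOK tk vs g = true) {x : I9' × I9' × I9' → K}
    (hx : x ∈ certSpan tk α β vs cert) {y : I9' × I9' × I9'} (hy : x y ≠ 0) :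
    rowWt tk (codeA y.1, codeA y.2.1, codeA y.2.2) ∈ certWts tk vs cert := by
  induction cert generalizing x with
  | nil => simp [certSpan] at hx; exact absurd (by rw [hx]; rfl) hy
  | cons g rest ih =>
    rw [certSpan, Submodule.mem_sup] at hx
    obtain ⟨u, hu, v, hv, rfl⟩ := hx
    obtain ⟨hc, hr⟩ := hall g (by simp)
    obtain ⟨w, hw⟩ := groupWt_isSome_of_rowsOK hr
    simp only [certWts, List.map_cons, hw, List.mem_cons]
    by_cases h : u y = 0
    · right
      exact ih (fun g' hg' => hall g' (by simp [hg'])) hv (by rw [Pi.add_apply, h, zero_add] at hy; exact hy)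
    · left
      exact colSpan_support hwf hc hw hu h

/-- Columns of a certificate with valid labels come from vectors of the list. [folklore] -/
theorem toFun_getD_mem {E : Submodule K (I9' × I9' → K)} (hE : ∀ v ∈ vs, v.toFun α β ∈ E)
    {g : CGroup} (hc : colsOK vs g = true) (r : Fin g.cols.length) :
    (vs.getD (g.cols.getD r (0, 0)).2 (.unit 0 0 0)).toFun α β ∈ E := by
  have hmem : g.cols.getD r (0, 0) ∈ g.cols := by
    rw [List.getD_eq_getElem?_getD, List.getElem?_eq_getElem r.isLt]; exact List.getElem_mem _
  have hlt : (g.cols.getD r (0, 0)).2 < vs.length := by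
    simp only [colsOK, List.all_eq_true] at hc
    exact (by simpa using hc _ hmem : _ ∧ _).2
  rw [List.getD_eq_getElem?_getD, List.getElem?_eq_getElem hlt]
  exact hE _ (List.getElem_mem _)

/-- The `(210)` certificate span lies in the skew image of `A ⊗ E`. [folklore] -/
theorem certSpan_le_I {E : Submodule K (I9' × I9' → K)} (hE : ∀ v ∈ vs, v.toFun α β ∈ E)
    {cert : List CGroup} (hcols : ∀ g ∈ cert, colsOK vs g = true) :
    certSpan false α β vs cert ≤ (slicesI E).map (skewIL (K := K)) := by
  induction cert with
  | nil => exact bot_le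
  | cons g rest ih =>
    rw [certSpan]
    refine sup_le (Submodule.span_le.2 ?_) (ih fun g' hg' => hcols g' (by simp [hg']))
    rintro _ ⟨r, rfl⟩
    simpa [colOf] using colI_mem α β (toFun_getD_mem hE (hcols g (by simp)) r) (decode9 (g.cols.getD r (0, 0)).1)

/-- The `(120)` certificate span lies in the skew image of `E ⊗ B`. [folklore] -/
theorem certSpan_le_K {E : Submodule K (I9' × I9' → K)} (hE : ∀ v ∈ vs, v.toFun α β ∈ E)
    {cert : List CGroup} (hcols : ∀ g ∈ cert, colsOK vs g = true) :
    certSpan true α β vs cert ≤ (slicesK E).map (skewKL (K := K)) := by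
  induction cert with
  | nil => exact bot_le
  | cons g rest ih =>
    rw [certSpan]
    refine sup_le (Submodule.span_le.2 ?_) (ih fun g' hg' => hcols g' (by simp [hg']))
    rintro _ ⟨r, rfl⟩
    simpa [colOf] using colK_mem α β (toFun_getD_mem hE (hcols g (by simp)) r) (decode9 (g.cols.getD r (0, 0)).1)

/-- Heads of strictly increasing lists are below the tail. [folklore] -/
theorem strictInc_cons {a : ℕ} {l : List ℕ} (h : strictInc (a :: l) = true) :
    (∀ b ∈ l, a < b) ∧ strictInc l = true := by
  induction l generalizing a with
  | nil => simp [strictInc]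
  | cons b rest ih =>
    simp only [strictInc, Bool.and_eq_true, decide_eq_true_eq] at h
    obtain ⟨hab, hrest⟩ := h
    have ih' := ih hrest
    refine ⟨fun c hc => ?_, hrest⟩
    rw [List.mem_cons] at hc
    rcases hc with rfl | hc
    · exact hab
    · exact hab.trans (ih'.1 c hc)

/-- **The certified rank is at most the dimension of the certificate span.**
[cite: ConnerHarperLandsberg2023, §6] -/
theorem certRank_le_finrank [CharZero K] (hwf : ∀ v ∈ vs, v.wf) {gen : Bool}
    (hgen : gen = true → α ≠ 0 ∧ β ≠ 0 ∧ α ≠ β) {cert : List CGroup} (hOK : certOK tk vs cert = true) :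
    certRank tk vs gen cert ≤ Module.finrank K (certSpan tk α β vs cert) := by
  induction cert with
  | nil => simp [certRank]
  | cons g rest ih =>
    simp only [certOK, List.all_cons, Bool.and_eq_true] at hOK
    obtain ⟨⟨⟨hc, hr⟩, hall⟩, hinc⟩ := hOK
    obtain ⟨w, hw⟩ := groupWt_isSome_of_rowsOK hr
    simp only [certWts, List.map_cons, hw] at hinc
    obtain ⟨hlt, hinc'⟩ := strictInc_cons hinc
    have hOK' : certOK tk vs rest = true := by
      simp only [certOK, Bool.and_eq_true]; exact ⟨hall, hinc'⟩
    have ih' := ih hOK'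
    have hall' : ∀ g' ∈ rest, colsOK vs g' = true ∧ rowsOK tk vs g' = true := by
      intro g' hg'; simpa using (List.all_eq_true.1 hall) g' hg'
    -- the two spans meet trivially
    have hinf : colSpan tk α β vs g ⊓ certSpan tk α β vs rest = ⊥ := by
      rw [eq_bot_iff]
      rintro x ⟨hx1, hx2⟩
      rw [Submodule.mem_bot]
      funext y
      by_contra hy
      have h1 := colSpan_support hwf hc hw hx1 hy
      have h2 := certSpan_support hwf hall' hx2 hy
      rw [h1] at h2
      exact lt_irrefl _ (hlt _ h2)
    have hsup := Submodule.finrank_sup_add_finrank_inf_eq (colSpan tk α β vs g) (certSpan tk α β vs rest)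
    rw [hinf, finrank_bot, add_zero] at hsup
    -- the group
    have hg : groupRank tk vs gen g ≤ Module.finrank K (colSpan tk α β vs g) := by
      unfold groupRank
      split_ifs with hcond
      · have hli := linearIndependent_of_groupCond hgen hc hr hcond
        rw [colSpan, finrank_span_eq_card hli, Fintype.card_fin, (groupCond_spec hcond).1]
      · exact Nat.zero_le _
    rw [certRank, List.map_cons, List.sum_cons, certSpan, hsup]
    exact Nat.add_le_add hg ih'

end Cert

/-! ## The bound -/

/-- **Soundness of the certified bound**: for any certificate, `dim testI E ≤ boundOf` (resp.
`testK`) whenever `E` contains the model vectors and `dim E ≤ |vs|`.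
[cite: ConnerHarperLandsberg2023, §3 and §6] -/
theorem finrank_test_le_boundOf [CharZero K] (tk : Bool) (α β : K) {vs : List MVec}
    (hwf : ∀ v ∈ vs, v.wf) {gen : Bool} (hgen : gen = true → α ≠ 0 ∧ β ≠ 0 ∧ α ≠ β)
    (cert : List CGroup) {E : Submodule K (I9' × I9' → K)} (hE : ∀ v ∈ vs, v.toFun α β ∈ E)
    (hdim : Module.finrank K E ≤ vs.length) :
    (if tk then Module.finrank K (testK E) else Module.finrank K (testI E)) ≤ boundOf tk vs gen cert := by
  have hcard : Fintype.card I9' = 9 := by simp [Fintype.card_prod, Fintype.card_fin]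
  unfold boundOf
  cases tk
  · have hrn := finrank_testI_add (K := K) E
    rw [finrank_slicesI, hcard] at hrn
    simp only [Bool.false_eq_true, if_false]
    split_ifs with hOK
    · have h1 := certRank_le_finrank (tk := false) hwf hgen hOK
      have h2 := Submodule.finrank_mono (certSpan_le_I (α := α) (β := β) hE
        (fun g hg => by
          simp only [certOK, Bool.and_eq_true, List.all_eq_true] at hOK
          exact (hOK.1 g hg).1))
      omega
    · omega
  · have hrn := finrank_testK_add (K := K) E
    rw [finrank_slicesK, hcard] at hrn
    simp only [if_true]
    split_ifs with hOK
    · have h1 := certRank_le_finrank (tk := true) hwf hgen hOK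
      have h2 := Submodule.finrank_mono (certSpan_le_K (α := α) (β := β) hE
        (fun g hg => by
          simp only [certOK, Bool.and_eq_true, List.all_eq_true] at hOK
          exact (hOK.1 g hg).1))
      omega
    · omega

/-- The model vectors of a profile are well-formed. [folklore] -/
theorem mvecs_wf (prof : List (List (ℕ × ℕ) × ℕ)) (var : ℕ) : ∀ v ∈ mvecs prof var, v.wf := by
  intro v hv
  simp only [mvecs, List.mem_flatMap, List.mem_range, List.mem_append, List.mem_map] at hv
  obtain ⟨jk, hjk, h⟩ := hv
  rcases h with ⟨d, _, rfl⟩ | ⟨ii', _, rfl⟩ <;> exact hjk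

/-- **Soundness of `boundT`**: `dim testI (E) ≤ boundT prof var false` and likewise for `testK`,
for any `E` containing the model vectors of the profile's variant with `dim E ≤` their number
(generic variant: `α, β, α - β ≠ 0`). [cite: ConnerHarperLandsberg2023, §6] -/
theorem finrank_test_le_boundT [CharZero K] (prof : List (List (ℕ × ℕ) × ℕ)) (var : ℕ) (tk : Bool)
    (α β : K) (hgen : (decide (0 < freeCount prof) && var == 0) = true → α ≠ 0 ∧ β ≠ 0 ∧ α ≠ β)
    {E : Submodule K (I9' × I9' → K)} (hE : ∀ v ∈ mvecs prof var, v.toFun α β ∈ E)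
    (hdim : Module.finrank K E ≤ (mvecs prof var).length) :
    (if tk then Module.finrank K (testK E) else Module.finrank K (testI E)) ≤ boundT prof var tk :=
  finrank_test_le_boundOf tk α β (mvecs_wf prof var) hgen _ hE hdim



end Ker

end MatMul3

end BorderApolarity

end Literature.Computability.AlgebraicComplexity

end
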